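import Summits.AtomisticToContinuum.FouriersLaw.Theorems.HiddenChargeMazurOddChargeAlgebraDefs
import Summits.AtomisticToContinuum.FouriersLaw.Theorems.HiddenChargeMazurDressedChargeStubAlgebraize
import Literature.MathematicalPhysics.KineticTheory.FouriersLaw

/-!
# Odd conservation laws of the pinned anharmonic chain — the bridge to the crux vocabulary

Support file (`--supports stmt-AtomisticToContinuum-13511`) of the NEGATIVE edge of the crux
`HiddenChargeMazur.OddChargeExists`.  The crux speaks about a polynomial window density
`g : (Fin (2R+1) → ℝ × ℝ) → ℝ`, a polynomial flux `ψ` on `2R+3` cells, momentum-oddness of `g` and the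
local conservation law of `pinnedChain ω₂ lam β γ` written with `deriv`, `Function.update` and a `tsum`
over the sites of a configuration `σ : ℤ → ℝ × ℝ`.  The classification theorem of the files
`HiddenChargeMazurOddChargeAlgebra*` speaks about the chain algebra `𝓡 = ℝ[q_x, p_x : x ∈ ℤ]`:
an odd (`rev g = -g`) element supported on the sites `0..M` whose Liouville derivative is a
`(1 - S)`-coboundary is itself `Sχ - χ` with `χ` on the sites `0..M-1`.

`oddPolynomialLaw_isCoboundary_of_ring` is the translation: ASSUMING the ring statement, every odd
polynomial local conservation law `g` of the crux is a shift-coboundary of window functions,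
`g y = h (y ∘ succ) - h (y ∘ castSucc) + k` (with `k = 0`).  The analytic-to-algebraic dictionary
(one-variable polynomial calculus `deriv (t ↦ p(σ[v ↦ t])) = (∂_v p)(σ)`, finiteness of the site sum,
`MvPolynomial.funext`) is the landed `DressedCharge.stub_algebraize` (same clauses, crux
`DressedCharge`), which places the window at the sites `-R..R`; here we translate by `R` sites
(the Liouville derivation, the momentum reversal and the shift commute with translations), apply the
ring statement with `M = 2R`, and read the potential `χ` (sites `0..2R-1`) back as a window function
of `2R` cells. [folklore]
-/

noncomputable section

open MvPolynomial
open scoped BigOperators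

namespace Summit.AtomisticToContinuum.FouriersLaw.Theorems.OddChargeAlgebra
open Literature.MathematicalPhysics.KineticTheory.HeatConduction

/-! ### Translations commute with the structure maps -/

/-- `shiftBy k` on a generator. [folklore] -/
private theorem shiftBy_X' (k : ℤ) (v : Var) : shiftBy k (X v : R) = X (transl k v) := by
  simp [shiftBy]

/-- `shiftBy k` fixes the scalars. [folklore] -/
private theorem shiftBy_C' (k : ℤ) (a : ℝ) : shiftBy k (C a : R) = C a := by
  simp [shiftBy]

/-- The Liouville derivation on a generator. [folklore] -/
private theorem liouville_X' (ω₂ lam β : ℝ) (v : Var) :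
    liouville ω₂ lam β (X v) = Sum.elim (fun x => (X (Sum.inr x) : R)) (fun x => force ω₂ lam β x) v := by
  simp [liouville, mkDerivation_X]

/-- The force is translation covariant: `shiftBy k (F_x) = F_{x+k}`. [folklore] -/
private theorem shiftBy_force' (ω₂ lam β : ℝ) (k x : ℤ) :
    shiftBy k (force ω₂ lam β x) = force ω₂ lam β (x + k) := by
  simp only [force, map_add, map_sub, map_neg, map_mul, map_pow, shiftBy_X', shiftBy_C', transl,
    Sum.map_inl]
  rw [show x + 1 + k = x + k + 1 by ring, show x - 1 + k = x + k - 1 by ring]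

/-- The Liouville derivation commutes with site translations. [folklore] -/
private theorem liouville_shiftBy' (ω₂ lam β : ℝ) (k : ℤ) (f : R) :
    liouville ω₂ lam β (shiftBy k f) = shiftBy k (liouville ω₂ lam β f) := by
  induction f using MvPolynomial.induction_on with
  | C a => rw [shiftBy_C', derivation_C, map_zero]
  | add p q hp hq => simp only [map_add, hp, hq]
  | mul_X p v hp =>
    have hv : liouville ω₂ lam β (X (transl k v)) = shiftBy k (liouville ω₂ lam β (X v)) := by
      rcases v with x | x
      · simp [liouville_X', transl, shiftBy_X']
      · simp [liouville_X', transl, shiftBy_force']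
    rw [map_mul, shiftBy_X', Derivation.leibniz, Derivation.leibniz, smul_eq_mul, smul_eq_mul,
      smul_eq_mul, smul_eq_mul, map_add, map_mul, map_mul, hp, hv, shiftBy_X']

/-- Momentum reversal commutes with site translations. [folklore] -/
private theorem rev_shiftBy' (k : ℤ) (f : R) : rev (shiftBy k f) = shiftBy k (rev f) := by
  induction f using MvPolynomial.induction_on with
  | C a => simp [rev]
  | add p q hp hq => simp only [map_add, hp, hq]
  | mul_X p v hp =>
    rw [map_mul, map_mul, map_mul, map_mul, hp]
    congr 1
    rcases v with x | x <;> simp [rev, shiftBy_X', transl]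

/-- The shift commutes with site translations. [folklore] -/
private theorem shift_shiftBy' (k : ℤ) (f : R) : shift (shiftBy k f) = shiftBy k (shift f) := by
  have e : (transl 1 ∘ transl k : Var → Var) = transl k ∘ transl 1 := by
    funext v
    rcases v with x | x <;>
      simp only [Function.comp_apply, transl, Sum.map_inl, Sum.map_inr, Sum.inl.injEq, Sum.inr.injEq] <;>
      omega
  simp only [shift, shiftBy, rename_rename, e]

/-- Two evaluations that agree on a set of variables supporting `f` agree on `f`. [folklore] -/
private theorem eval_eq_eval_of_mem_supported' {S : Set Var} {f : R} (hf : f ∈ supported ℝ S)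
    {v₁ v₂ : Var → ℝ} (h : ∀ w ∈ S, v₁ w = v₂ w) : eval v₁ f = eval v₂ f := by
  rw [supported_eq_range_rename, AlgHom.mem_range] at hf
  obtain ⟨f₀, rfl⟩ := hf
  have e : v₁ ∘ (Subtype.val : S → Var) = v₂ ∘ (Subtype.val : S → Var) := funext fun w => h w w.2
  rw [eval_rename, eval_rename, e]

/-! ### The bridge -/

/-- **Bridge.** Assume the ring-level classification: every odd `g ∈ 𝓡` supported on the sites
`0..M` with `liouville ω₂ lam β g ∈ (1 - S)𝓡` is `Sχ - χ` with `χ` on the sites `0..M-1`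
(`lam ≠ 0`, `β ≠ 0`).  Then every momentum-odd polynomial window density `g` on `2R+1` cells of
`pinnedChain ω₂ lam β γ` satisfying the crux's local conservation law (polynomial flux `ψ`) is a
shift-coboundary of window functions: `g y = h (y ∘ succ) - h (y ∘ castSucc) + k`.  Proof: by
`DressedCharge.stub_algebraize` the clauses give `G, Ψ ∈ 𝓡`, `G` on the sites `-R..R`, with
`g (σ(· - R)) = eval_σ G`, `rev G = -G`, `liouville G = Ψ - SΨ`; translate by `R` sites, apply the
assumption with `M = 2R`, and evaluate `shiftBy R G = Sχ - χ` at the zero-padded configuration of a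
window `y` (the potential is `h w = eval_{w} χ`, `k = 0`). [folklore] -/
theorem oddPolynomialLaw_isCoboundary_of_ring : (∀ (ω₂ lam β : ℝ) (M : ℕ) (g ψ : R), lam ≠ 0 → β ≠ 0 → g ∈ supported ℝ (Var.site ⁻¹' Set.Icc (0 : ℤ) M) → rev g = -g → liouville ω₂ lam β g = ψ - shift ψ → ∃ χ : R, χ ∈ supported ℝ (Var.site ⁻¹' Set.Icc (0 : ℤ) ((M : ℤ) - 1)) ∧ g = shift χ - χ) → ∀ ω₂ lam β γ : ℝ, lam ≠ 0 → β ≠ 0 → ∀ P : OscillatorChain, P = pinnedChain ω₂ lam β γ → ∀ (R : ℕ) (g : (Fin (2 * R + 1) → ℝ × ℝ) → ℝ) (ψ : (Fin (2 * (R + 1) + 1) → ℝ × ℝ) → ℝ), (∃ p : MvPolynomial (Fin (2 * R + 1) ⊕ Fin (2 * R + 1)) ℝ, ∀ y : Fin (2 * R + 1) → ℝ × ℝ, g y = MvPolynomial.eval (Sum.elim (fun i => (y i).1) (fun i => (y i).2)) p) → (∃ p : MvPolynomial (Fin (2 * (R + 1) + 1) ⊕ Fin (2 * (R + 1) + 1))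 ℝ, ∀ y : Fin (2 * (R + 1) + 1) → ℝ × ℝ, ψ y = MvPolynomial.eval (Sum.elim (fun i => (y i).1) (fun i => (y i).2)) p) → (∀ y : Fin (2 * R + 1) → ℝ × ℝ, g (fun i => ((y i).1, -(y i).2)) = -g y) → (∀ σ : ℤ → ℝ × ℝ, (∑' x : ℤ, ((σ x).2 * deriv (fun t => g (fun i : Fin (2 * R + 1) => Function.update σ x (t, (σ x).2) ((i : ℤ) - (R : ℕ)))) (σ x).1 + (-deriv P.U (σ x).1 + (deriv P.V ((σ (x + 1)).1 - (σ x).1) - deriv P.V ((σ x).1 - (σ (x - 1)).1))) * deriv (fun t => g (fun i : Fin (2 * R + 1) => Function.update σ x ((σ x).1, t) ((i : ℤ) - (R : ℕ)))) (σ x).2)) = ψ (fun i : Fin (2 * (R + 1) + 1) => σ ((i : ℤ) - (R + 1 : ℕ))) - ψ (fun i : Fin (2 * (R + 1) + 1) => σ ((i : ℤ) - (R + 1 : ℕ) + 1))) → ∃ (h : (Fin (2 * R) → ℝ × ℝ) → ℝ) (k : ℝ), ∀ y : Fin (2 * R + 1) → ℝ × ℝ, g y = h (fun i : Fin (2 *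 R) => y i.succ) - h (fun i : Fin (2 * R) => y i.castSucc) + k := by
  intro hring ω₂ lam β γ hlam hβ P hP N g ψ hg hψ hodd hlaw
  -- (1) the dictionary: `G` on the sites `-N..N`, `Ψ`, oddness and the ring law
  obtain ⟨G, Ψ, hvars, hGeval, hGodd, hGlaw⟩ :=
    DressedCharge.stub_algebraize ω₂ lam β γ P hP N g ψ hg hψ hodd hlaw
  have hGodd' : rev G = -G := hGodd
  have hGlaw' : liouville ω₂ lam β G = Ψ - shift Ψ := hGlaw
  -- (2) translate by `N` sites: `shiftBy N G` lives on the sites `0..2N`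
  have hsupp : shiftBy (N : ℤ) G ∈ supported ℝ (Var.site ⁻¹' Set.Icc (0 : ℤ) ((2 * N : ℕ) : ℤ)) := by
    classical
    rw [mem_supported]
    intro v hv
    have hv' : v ∈ (rename (transl (N : ℤ)) G).vars := hv
    obtain ⟨w, hw, rfl⟩ := Finset.mem_image.1 (vars_rename _ _ hv')
    have h := hvars w hw
    simp only [Set.mem_Icc] at h
    simp only [Set.mem_preimage, Set.mem_Icc, Nat.cast_mul, Nat.cast_ofNat]
    rcases w with x | x <;>
      simp only [Var.site, transl, Sum.map_inl, Sum.map_inr, Sum.elim_inl, Sum.elim_inr, id] at h ⊢ <;>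
      omega
  have hodd' : rev (shiftBy (N : ℤ) G) = -shiftBy (N : ℤ) G := by
    rw [rev_shiftBy', hGodd', map_neg]
  have hlaw' : liouville ω₂ lam β (shiftBy (N : ℤ) G) = shiftBy (N : ℤ) Ψ - shift (shiftBy (N : ℤ) Ψ) := by
    rw [liouville_shiftBy', hGlaw', map_sub, shift_shiftBy']
  -- (3) the ring-level classification
  obtain ⟨χ, hχ, hGχ⟩ := hring ω₂ lam β (2 * N) (shiftBy (N : ℤ) G) (shiftBy (N : ℤ) Ψ) hlam hβ hsupp hodd' hlaw'
  -- (4) read `χ` back as a window function of `2N` cells (zero-padded configurations)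
  obtain ⟨ext, hext⟩ : ∃ ext : (Fin (2 * N) → ℝ × ℝ) → ℤ → ℝ × ℝ, ∀ w x, ext w x =
      if h : 0 ≤ x ∧ x < 2 * (N : ℤ) then w ⟨x.toNat, by omega⟩ else 0 := ⟨_, fun _ _ => rfl⟩
  refine ⟨fun w => eval (Sum.elim (fun x : ℤ => (ext w x).1) (fun x : ℤ => (ext w x).2)) χ, 0, fun y => ?_⟩
  obtain ⟨y', hy'⟩ : ∃ y' : ℤ → ℝ × ℝ, ∀ x, y' x =
      if h : 0 ≤ x ∧ x < 2 * (N : ℤ) + 1 then y ⟨x.toNat, by omega⟩ else 0 := ⟨_, fun _ => rfl⟩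
  -- the window of the configuration `x ↦ y' (x + N)` around `0` is `y`
  have hwin : (fun i : Fin (2 * N + 1) => (fun x : ℤ => y' (x + N)) ((i : ℤ) - (N : ℕ))) = y := by
    funext i
    have hi := i.isLt
    simp only [sub_add_cancel]
    rw [hy', dif_pos (by omega)]
    exact congrArg y (Fin.ext (by simp))
  have hflat : (Sum.elim (fun x : ℤ => (y' x).1) (fun x : ℤ => (y' x).2) : Var → ℝ) ∘ transl (N : ℤ) =
      Sum.elim (fun x : ℤ => ((fun x : ℤ => y' (x + N)) x).1) (fun x : ℤ => ((fun x : ℤ => y' (x + N)) x).2) := by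
    funext v
    rcases v with x | x <;> simp [transl]
  -- `g y = (shiftBy N G)(y') = (Sχ)(y') - χ(y')`
  have h1 : g y = eval (Sum.elim (fun x : ℤ => (y' x).1) (fun x : ℤ => (y' x).2)) (shift χ) -
      eval (Sum.elim (fun x : ℤ => (y' x).1) (fun x : ℤ => (y' x).2)) χ := by
    rw [← map_sub, ← hGχ]
    calc g y = g (fun i : Fin (2 * N + 1) => (fun x : ℤ => y' (x + N)) ((i : ℤ) - (N : ℕ))) := by rw [hwin]
      _ = eval ((Sum.elim (fun x : ℤ => (y' x).1) (fun x : ℤ => (y' x).2) : Var → ℝ) ∘ transl (N : ℤ)) G := by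
          rw [hflat]
          exact hGeval (fun x : ℤ => y' (x + N))
      _ = eval (Sum.elim (fun x : ℤ => (y' x).1) (fun x : ℤ => (y' x).2)) (shiftBy (N : ℤ) G) := by
          rw [shiftBy, eval_rename]
  -- the two potentials
  have hsucc : eval (Sum.elim (fun x : ℤ => (ext (fun i : Fin (2 * N) => y i.succ) x).1)
      (fun x : ℤ => (ext (fun i : Fin (2 * N) => y i.succ) x).2)) χ =
      eval (Sum.elim (fun x : ℤ => (y' x).1) (fun x : ℤ => (y' x).2)) (shift χ) := by
    rw [shift, shiftBy, eval_rename]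
    refine eval_eq_eval_of_mem_supported' hχ (fun v hv => ?_)
    simp only [Set.mem_preimage, Set.mem_Icc] at hv
    rcases v with x | x
    · simp only [Var.site, Sum.elim_inl, id] at hv
      simp only [Sum.elim_inl, Function.comp_apply, transl, Sum.map_inl]
      rw [hext, hy', dif_pos (by omega), dif_pos (by omega)]
      exact congrArg (fun i => (y i).1) (Fin.ext (by simp only [Fin.val_succ]; omega))
    · simp only [Var.site, Sum.elim_inr, id] at hv
      simp only [Sum.elim_inr, Function.comp_apply, transl, Sum.map_inr]
      rw [hext, hy', dif_pos (by omega), dif_pos (by omega)]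
      exact congrArg (fun i => (y i).2) (Fin.ext (by simp only [Fin.val_succ]; omega))
  have hcast : eval (Sum.elim (fun x : ℤ => (ext (fun i : Fin (2 * N) => y i.castSucc) x).1)
      (fun x : ℤ => (ext (fun i : Fin (2 * N) => y i.castSucc) x).2)) χ =
      eval (Sum.elim (fun x : ℤ => (y' x).1) (fun x : ℤ => (y' x).2)) χ := by
    refine eval_eq_eval_of_mem_supported' hχ (fun v hv => ?_)
    simp only [Set.mem_preimage, Set.mem_Icc] at hv
    rcases v with x | x
    · simp only [Var.site, Sum.elim_inl, id] at hv
      simp only [Sum.elim_inl]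
      rw [hext, hy', dif_pos (by omega), dif_pos (by omega)]
      exact congrArg (fun i => (y i).1) (Fin.ext (by simp))
    · simp only [Var.site, Sum.elim_inr, id] at hv
      simp only [Sum.elim_inr]
      rw [hext, hy', dif_pos (by omega), dif_pos (by omega)]
      exact congrArg (fun i => (y i).2) (Fin.ext (by simp))
  beta_reduce
  rw [h1, add_zero, hsucc, hcast]

end Summit.AtomisticToContinuum.FouriersLaw.Theorems.OddChargeAlgebra

end
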